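import Summits.CriticalPhenomena.PercolationContinuityZ3.Theorems.PercNearOneGluingNoHeavyLowerTailSahiE3JuntaMeetBlock
import Mathlib.Tactic.Linarith
import Mathlib.Tactic.Ring
import HarnessLib

/-!
# `NoHeavyLowerTail` (crux stmt-CriticalPhenomena-4575), Sahi programme P4: Sahi's `E₃ ≥ 0` for an INDEPENDENT pair, and — by
# locality — whenever `A ∩ B` is determined by a block on which the top sections of `A` and `B` live on disjoint coordinates

Support file (cell `prim-l12`, seat P4, generation 3; `--supports stmt-CriticalPhenomena-4575`).  No named facts, no sorries, no
definitions.

* `ED_sahiE3_nonneg_of_indep` — on the weighted cube `W₁ ∪ W₂` (`W₁ ∩ W₂ = ∅`, `p ∈ [0,1]`): if `f` depends only on the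
  `W₁`-coordinates and `g` only on the `W₂`-coordinates (both monotone, nonnegative), then `E₃(t, f, g) ≥ 0` for every monotone
  `t` (no sign needed).  (Independent pair: `E[fg] = Ef·Eg`, so `E₃ = 2E[tfg] − Ef·E[tg] − Eg·E[tf]`, and `E[tfg] ≥ Ef·E[tg]`, `E[tfg] ≥ Eg·E[tf]` by
  Harris on `W₁`, resp. `W₂`, fibrewise.)  Elementary and folklore in content; recorded in the `ED` calculus for the corollary.
* **`sahiE3_nonneg_of_mul_junta_of_indepSections`** — UNCONDITIONAL CLASS via the transfer theorem
  `sahiE3_nonneg_of_mul_junta_of_block` (`…SahiE3JuntaMeetBlock`): on the weighted cube `(W₁ ∪ W₂) ∪ D` (pairwise disjoint), for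
  monotone `{0,1}`-valued `u, f, g` with `f·g` determined by the block `W₁ ∪ W₂`, the top section `f(D ∪ ·)` depending only on `W₁`
  and `g(D ∪ ·)` only on `W₂`: `E₃(u,f,g) ≥ 0`.  Example: `A = (X₁ ∨ X₂) ∧ (X₃ ∨ X₄ ∨ X₅)`, `B = (X₃ ∨ X₄) ∧ (X₁ ∨ X₂ ∨ X₆)`,
  `A ∩ B = (X₁ ∨ X₂)(X₃ ∨ X₄)` (`W₁ = {1,2}`, `W₂ = {3,4}`, `D = {5,6}`), `U` arbitrary; the blocks `W₁, W₂` may have any size.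
  [this work]
-/

noncomputable section

namespace Summit.CriticalPhenomena.PercolationContinuityZ3.Theorems

namespace SahiE3JuntaMeet

open Finset Literature.Probability.Percolation Literature.Probability.Percolation.DecisionTree SahiE3PrincipalMeet

variable {ι : Type*} [DecidableEq ι]

/-- **Sahi's `E₃ ≥ 0` for an independent pair.**  On the weighted cube `W₁ ∪ W₂` (`W₁ ∩ W₂ = ∅`, `p ∈ [0,1]`), let `t, f, g` be
monotone, `f, g` nonnegative, with `f(Z ∪ T) = f T` and `g(Z ∪ T) = g Z` for `Z ⊆ W₂`, `T ⊆ W₁` (`f` is `W₁`-determined, `g` is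
`W₂`-determined).  Then `2E[tfg] + Et·Ef·Eg − Et·E[fg] − Ef·E[tg] − Eg·E[tf] ≥ 0`. [folklore; via Harris fibrewise] -/
theorem ED_sahiE3_nonneg_of_indep (W₁ W₂ : Finset ι) (hW : Disjoint W₁ W₂) {p : ι → ℝ} (hp0 : ∀ i, 0 ≤ p i)
    (hp1 : ∀ i, p i ≤ 1) {t f g : Finset ι → ℝ}
    (ht : ∀ ⦃S T : Finset ι⦄, S ⊆ T → t S ≤ t T)
    (hf : ∀ ⦃S T : Finset ι⦄, S ⊆ T → f S ≤ f T) (hf0 : ∀ S, 0 ≤ f S)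
    (hg : ∀ ⦃S T : Finset ι⦄, S ⊆ T → g S ≤ g T) (hg0 : ∀ S, 0 ≤ g S)
    (hf1 : ∀ Z, Z ⊆ W₂ → ∀ T, T ⊆ W₁ → f (Z ∪ T) = f T) (hg2 : ∀ Z, Z ⊆ W₂ → ∀ T, T ⊆ W₁ → g (Z ∪ T) = g Z) :
    0 ≤ 2 * ED (W₁ ∪ W₂) p (fun S => t S * f S * g S)
          + ED (W₁ ∪ W₂) p t * ED (W₁ ∪ W₂) p f * ED (W₁ ∪ W₂) p g
          - ED (W₁ ∪ W₂) p t * ED (W₁ ∪ W₂) p (fun S => f S * g S)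
          - ED (W₁ ∪ W₂) p f * ED (W₁ ∪ W₂) p (fun S => t S * g S)
          - ED (W₁ ∪ W₂) p g * ED (W₁ ∪ W₂) p (fun S => t S * f S) := by
  have hW' : Disjoint W₂ W₁ := hW.symm
  -- Fubini: outer `W₂` (configurations `Z`), inner `W₁` (configurations `T`)
  have fub : ∀ φ : Finset ι → ℝ, ED (W₁ ∪ W₂) p φ = ED W₂ p (fun Z => ED W₁ p (fun T => φ (Z ∪ T))) := fun φ => by
    rw [Finset.union_comm]; exact ED_union W₂ W₁ hW' p φ
  obtain ⟨a, ha⟩ : ∃ x : ℝ, x = ED W₁ p f := ⟨_, rfl⟩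
  obtain ⟨b, hb⟩ : ∃ x : ℝ, x = ED W₂ p g := ⟨_, rfl⟩
  have ha0 : 0 ≤ a := by rw [ha]; exact ED_nonneg W₁ hp0 hp1 fun S _ => hf0 S
  have hb0 : 0 ≤ b := by rw [hb]; exact ED_nonneg W₂ hp0 hp1 fun S _ => hg0 S
  -- the marginals
  have eF : ED (W₁ ∪ W₂) p f = a := by
    rw [fub, ha, ← ED_const W₂ p (ED W₁ p f)]
    exact ED_congr_sub W₂ p fun Z hZ => ED_congr_sub W₁ p fun T hT => hf1 Z hZ T hT
  have eG : ED (W₁ ∪ W₂) p g = b := by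
    rw [fub, hb]
    refine ED_congr_sub W₂ p fun Z hZ => ?_
    show ED W₁ p (fun T => g (Z ∪ T)) = g Z
    rw [← ED_const W₁ p (g Z)]
    exact ED_congr_sub W₁ p fun T hT => hg2 Z hZ T hT
  have eFG : ED (W₁ ∪ W₂) p (fun S => f S * g S) = a * b := by
    rw [fub, hb, ← ED_mul_left]
    refine ED_congr_sub W₂ p fun Z hZ => ?_
    show ED W₁ p (fun T => f (Z ∪ T) * g (Z ∪ T)) = a * g Z
    rw [ha, mul_comm, ← ED_mul_left]
    exact ED_congr_sub W₁ p fun T hT => by rw [hf1 Z hZ T hT, hg2 Z hZ T hT, mul_comm]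
  -- the two fibrewise Harris inequalities
  have h1 : a * ED (W₁ ∪ W₂) p (fun S => t S * g S) ≤ ED (W₁ ∪ W₂) p (fun S => t S * f S * g S) := by
    rw [fub (fun S => t S * g S), fub (fun S => t S * f S * g S), ← ED_mul_left]
    refine ED_mono W₂ hp0 hp1 fun Z hZ => ?_
    show a * ED W₁ p (fun T => t (Z ∪ T) * g (Z ∪ T)) ≤ ED W₁ p (fun T => t (Z ∪ T) * f (Z ∪ T) * g (Z ∪ T))
    have e1 : ED W₁ p (fun T => t (Z ∪ T) * g (Z ∪ T)) = g Z * ED W₁ p (fun T => t (Z ∪ T)) := by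
      rw [← ED_mul_left]; exact ED_congr_sub W₁ p fun T hT => by rw [hg2 Z hZ T hT, mul_comm]
    have e2 : ED W₁ p (fun T => t (Z ∪ T) * f (Z ∪ T) * g (Z ∪ T)) = g Z * ED W₁ p (fun T => t (Z ∪ T) * f T) := by
      rw [← ED_mul_left]; exact ED_congr_sub W₁ p fun T hT => by rw [hf1 Z hZ T hT, hg2 Z hZ T hT]; ring
    have hH : ED W₁ p (fun T => t (Z ∪ T)) * a ≤ ED W₁ p (fun T => t (Z ∪ T) * f T) := by
      rw [ha]
      exact ED_mul_ED_le_ED_mul W₁ hp0 hp1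
        (fun S T hST => ht (Finset.union_subset_union (Finset.Subset.refl Z) hST)) hf
    rw [e1, e2]
    have := mul_le_mul_of_nonneg_left hH (hg0 Z)
    nlinarith [this]
  have fub' : ∀ φ : Finset ι → ℝ, ED (W₁ ∪ W₂) p φ = ED W₁ p (fun T => ED W₂ p (fun Z => φ (T ∪ Z))) := fun φ =>
    ED_union W₁ W₂ hW p φ
  have h2 : b * ED (W₁ ∪ W₂) p (fun S => t S * f S) ≤ ED (W₁ ∪ W₂) p (fun S => t S * f S * g S) := by
    rw [fub' (fun S => t S * f S), fub' (fun S => t S * f S * g S), ← ED_mul_left]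
    refine ED_mono W₁ hp0 hp1 fun T hT => ?_
    show b * ED W₂ p (fun Z => t (T ∪ Z) * f (T ∪ Z)) ≤ ED W₂ p (fun Z => t (T ∪ Z) * f (T ∪ Z) * g (T ∪ Z))
    have e1 : ED W₂ p (fun Z => t (T ∪ Z) * f (T ∪ Z)) = f T * ED W₂ p (fun Z => t (T ∪ Z)) := by
      rw [← ED_mul_left]; exact ED_congr_sub W₂ p fun Z hZ => by rw [Finset.union_comm, hf1 Z hZ T hT, mul_comm]
    have e2 : ED W₂ p (fun Z => t (T ∪ Z) * f (T ∪ Z) * g (T ∪ Z)) = f T * ED W₂ p (fun Z => t (T ∪ Z) * g Z) := by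
      rw [← ED_mul_left]; exact ED_congr_sub W₂ p fun Z hZ => by
        rw [Finset.union_comm, hf1 Z hZ T hT, hg2 Z hZ T hT]; ring
    have hH : ED W₂ p (fun Z => t (T ∪ Z)) * b ≤ ED W₂ p (fun Z => t (T ∪ Z) * g Z) := by
      rw [hb]
      exact ED_mul_ED_le_ED_mul W₂ hp0 hp1
        (fun S S' hSS' => ht (Finset.union_subset_union (Finset.Subset.refl T) hSS')) hg
    rw [e1, e2]
    have := mul_le_mul_of_nonneg_left hH (hf0 T)
    nlinarith [this]
  rw [eF, eG, eFG]
  nlinarith [h1, h2]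

/-- **Sahi's `E₃ ≥ 0` when `A ∩ B` is determined by a block on which the top sections of `A` and `B` are independent.**  On the
weighted cube `(W₁ ∪ W₂) ∪ D` (`W₁, W₂, D` pairwise disjoint, `p ∈ [0,1]`), let `u, f, g` be monotone `{0,1}`-valued with
`f(Z ∪ T)·g(Z ∪ T) = f(D ∪ T)·g(D ∪ T)` (`Z ⊆ D`, `T ⊆ W₁ ∪ W₂`), and suppose the top section `f(D ∪ ·)` depends only on `W₁` and
`g(D ∪ ·)` only on `W₂` (`f(D ∪ (Z ∪ T)) = f(D ∪ T)`, `g(D ∪ (Z ∪ T)) = g(D ∪ Z)` for `Z ⊆ W₂`, `T ⊆ W₁`).  Then `E₃(u,f,g) ≥ 0`.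
[this work; `sahiE3_nonneg_of_mul_junta_of_block` + `ED_sahiE3_nonneg_of_indep`] -/
theorem sahiE3_nonneg_of_mul_junta_of_indepSections (W₁ W₂ D : Finset ι) (hW : Disjoint W₁ W₂)
    (hWD : Disjoint (W₁ ∪ W₂) D) {p : ι → ℝ} (hp0 : ∀ i, 0 ≤ p i) (hp1 : ∀ i, p i ≤ 1) {u f g : Finset ι → ℝ}
    (hu : ∀ ⦃S T : Finset ι⦄, S ⊆ T → u S ≤ u T) (hu01 : ∀ S, u S = 0 ∨ u S = 1)
    (hf : ∀ ⦃S T : Finset ι⦄, S ⊆ T → f S ≤ f T) (hf01 : ∀ S, f S = 0 ∨ f S = 1)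
    (hg : ∀ ⦃S T : Finset ι⦄, S ⊆ T → g S ≤ g T) (hg01 : ∀ S, g S = 0 ∨ g S = 1)
    (hfg : ∀ Z, Z ⊆ D → ∀ T, T ⊆ W₁ ∪ W₂ → f (Z ∪ T) * g (Z ∪ T) = f (D ∪ T) * g (D ∪ T))
    (hf1 : ∀ Z, Z ⊆ W₂ → ∀ T, T ⊆ W₁ → f (D ∪ (Z ∪ T)) = f (D ∪ T))
    (hg2 : ∀ Z, Z ⊆ W₂ → ∀ T, T ⊆ W₁ → g (D ∪ (Z ∪ T)) = g (D ∪ Z)) :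
    0 ≤ 2 * ED ((W₁ ∪ W₂) ∪ D) p (fun S => u S * f S * g S)
          + ED ((W₁ ∪ W₂) ∪ D) p u * ED ((W₁ ∪ W₂) ∪ D) p f * ED ((W₁ ∪ W₂) ∪ D) p g
          - ED ((W₁ ∪ W₂) ∪ D) p u * ED ((W₁ ∪ W₂) ∪ D) p (fun S => f S * g S)
          - ED ((W₁ ∪ W₂) ∪ D) p f * ED ((W₁ ∪ W₂) ∪ D) p (fun S => u S * g S)
          - ED ((W₁ ∪ W₂) ∪ D) p g * ED ((W₁ ∪ W₂) ∪ D) p (fun S => u S * f S) := by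
  have hf0 : ∀ S, 0 ≤ f S := fun S => by rcases hf01 S with h | h <;> norm_num [h]
  have hg0 : ∀ S, 0 ≤ g S := fun S => by rcases hg01 S with h | h <;> norm_num [h]
  refine sahiE3_nonneg_of_mul_junta_of_block (W₁ ∪ W₂) D hWD hp0 hp1 hu hu01 hf hf01 hg hg01 hfg ?_
  intro t ht _
  exact ED_sahiE3_nonneg_of_indep W₁ W₂ hW hp0 hp1 ht
    (f := fun S => f (D ∪ S)) (g := fun S => g (D ∪ S))
    (fun S T hST => hf (Finset.union_subset_union (Finset.Subset.refl D) hST)) (fun S => hf0 _)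
    (fun S T hST => hg (Finset.union_subset_union (Finset.Subset.refl D) hST)) (fun S => hg0 _)
    (fun Z hZ T hT => hf1 Z hZ T hT) (fun Z hZ T hT => hg2 Z hZ T hT)

end SahiE3JuntaMeet

end Summit.CriticalPhenomena.PercolationContinuityZ3.Theorems

end
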